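import Summits.HubbardSuperconductivity.HubbardSuperconductivity.Theorems.AnisotropyChordTransferFibre3B1EvalLemmas

/-!
# Route `AnisotropyChord` / H0 rotor rung, LEVEL 2 family B1: SOUNDNESS of the exact-integer cell evaluator

★ `cell_sound`: `cellCheck L₀ n₁ n₂ νd Tn Td S s a n D clo chi = true` (`…Fibre3B1Eval`, one `decide +kernel`) ⟹ for every
`L ≥ L₀` and every `ν ∈ [n₁/νd, n₂/νd]`: `clo ≤ (2π/L)^{2n} · torSum L (ν(2π/L)²) s a ≤ chi` — via `B1.b1Bracket_cell` at
`θ₀ = 2π/L₀`, `K = L₀/4` and the three evaluations `loSumZ_le`, `hiSum_le_hiSumZ`, `tailConst_le_tailConstQ`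
(`…Fibre3B1EvalLemmas`).  This is the kernel interface of LEVEL2-SPEC §6 item 5 for every family-B1 named sum
(PartN41-B §3 `S₂…G13`, PartN41-D triple sums): one Boolean fact per (sum, ν-cell) gives real-number bounds valid for all
`L ≥ L₀`.
Prover seat `hubbard-h0-rotor-p2` g4; helper for piece A = stmt-HubbardSuperconductivity-23918 of rung 19089
(`--supports`, helper class).  Nothing here proves superconductivity in the Hubbard model; helper lemmas of ONE conditional
reduction (the GM₃ ∀L certificate, Level-2 rows); the rotor TARGET as originally worded stays FALSE (g15 verdict).
Mathlib + the tree only; no sorry.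
-/

set_option linter.dupNamespace false
set_option autoImplicit false

noncomputable section

open scoped BigOperators

namespace Summit.HubbardSuperconductivity.HubbardSuperconductivity.Theorems.AnisotropyChord.Transfer.Fibre3.B1

/-! ## The cell certificate is sound -/

/-- ★★ **SOUNDNESS OF THE CELL CERTIFICATE**: if `cellCheck L₀ n₁ n₂ νd Tn Td S s a n D clo chi = true` then for every
`L ≥ L₀` and every `ν ∈ [n₁/νd, n₂/νd]`:  `clo ≤ (2π/L)^{2n} · torSum L (ν·(2π/L)²) s a ≤ chi`. -/
theorem cell_sound (L0 : ℕ) (n1 n2 νd Tn Td : ℤ) (S : ℕ) {m : ℕ} (s : Fin m → ℤ × ℤ) (a : Fin m → ℕ) (n D : ℕ)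
    (clo chi : ℚ) (h : cellCheck L0 n1 n2 νd Tn Td S s a n D clo chi = true)
    (L : ℕ) [NeZero L] (hL : L0 ≤ L) (ν : ℝ) (hν1 : (n1 : ℝ) / νd ≤ ν) (hν2 : ν ≤ (n2 : ℝ) / νd) :
    ((clo : ℚ) : ℝ) ≤ (2 * Real.pi / L) ^ (2 * n) * torSum L (ν * (2 * Real.pi / L) ^ 2) s a ∧
      (2 * Real.pi / L) ^ (2 * n) * torSum L (ν * (2 * Real.pi / L) ^ 2) s a ≤ ((chi : ℚ) : ℝ) := by
  unfold cellCheck at h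
  simp only [Bool.and_eq_true, decide_eq_true_eq, List.all_eq_true] at h
  obtain ⟨⟨⟨⟨⟨⟨⟨⟨⟨⟨⟨⟨⟨hνd, hTd⟩, hn1⟩, hn12⟩, hc⟩, hT⟩, hK⟩, hD⟩, h2⟩, hsum⟩, hsa⟩, hpos⟩, hlo⟩, hhi⟩ := h
  have hpi := Real.pi_pos
  have hP : Real.pi ≤ ((piHi : ℚ) : ℝ) := by
    have e : ((piHi : ℚ) : ℝ) = 3.1416 := by unfold piHi; norm_num
    rw [e]
    exact Real.pi_lt_d4.le
  -- exponents and shifts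
  have ha : ∀ t, 1 ≤ a t := fun t => (hsa t (List.mem_finRange t)).1.1
  have hS : ∀ t, (s t).1.natAbs ≤ S ∧ (s t).2.natAbs ≤ S := fun t =>
    ⟨(hsa t (List.mem_finRange t)).1.2, (hsa t (List.mem_finRange t)).2⟩
  have hn : ∑ t, a t = n := by rw [← hsum, list_sum_finRange]
  -- the cell endpoints
  have hνdR : (0 : ℝ) < νd := by exact_mod_cast hνd
  have hν1_0 : (0 : ℝ) ≤ (n1 : ℝ) / νd := div_nonneg (by exact_mod_cast hn1) hνdR.le
  have hn2R : (0 : ℝ) ≤ (n2 : ℝ) / νd := div_nonneg (by exact_mod_cast (hn1.trans hn12)) hνdR.le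
  have hcR : (n2 : ℝ) / νd * (((piHi : ℚ) : ℝ)) ^ 2 < 4 := by exact_mod_cast hc
  have hν2_lt : (n2 : ℝ) / νd < 4 / Real.pi ^ 2 := by
    rw [lt_div_iff₀ (by positivity)]
    have : Real.pi ^ 2 ≤ (((piHi : ℚ) : ℝ)) ^ 2 := pow_le_pow_left₀ hpi.le hP 2
    nlinarith
  -- scales
  have hL0pos : 0 < L0 := by omega
  obtain ⟨hθ0, hθ0K⟩ := scales_of_L0 L L0 hL0pos hL
  -- the bracket on the cell
  obtain ⟨hmid_lo, hmid_hi⟩ := b1Bracket_cell L (2 * Real.pi / L0) (L0 / 4) S s a n ha hn h2 hS hK hθ0 hθ0K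
    ((n1 : ℝ) / νd) ν ((n2 : ℝ) / νd) hν1_0 hν1 hν2 hν2_lt
  -- T dominates θ₀²
  have hL0R : (0 : ℝ) < L0 := by exact_mod_cast hL0pos
  have hTd' : (0 : ℝ) < Td := by exact_mod_cast hTd
  have hTR : (2 * Real.pi / L0) ^ 2 * (Td : ℝ) ≤ Tn := by
    have h1 : (2 * Real.pi / L0) ^ 2 ≤ (2 * (((piHi : ℚ) : ℝ)) / L0) ^ 2 := by
      apply pow_le_pow_left₀ (by positivity)
      exact div_le_div_of_nonneg_right (by linarith) hL0R.le
    have h2' : (2 * (((piHi : ℚ) : ℝ)) / L0) ^ 2 * (Td : ℝ) ≤ Tn := by exact_mod_cast hT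
    nlinarith
  -- the three evaluations
  have hDR : (0 : ℝ) < D := by exact_mod_cast hD
  have elo := loSumZ_le n1 νd hνd (by
      have : (n1 : ℚ) / νd * piHi ^ 2 < 4 := lt_of_le_of_lt (by
        apply mul_le_mul_of_nonneg_right _ (by positivity)
        exact div_le_div_of_nonneg_right (by exact_mod_cast hn12) (by exact_mod_cast hνd.le)) hc
      have hP3 : (3 : ℚ) ≤ piHi := by unfold piHi; norm_num
      have hνdQ : (0 : ℚ) < νd := by exact_mod_cast hνd
      by_contra hcon
      push Not at hcon
      have : (1 : ℚ) ≤ (n1 : ℚ) / νd := by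
        rw [le_div_iff₀ hνdQ, one_mul]; exact_mod_cast (by linarith : νd ≤ n1)
      nlinarith) (L0 / 4) S s a n D hn
  have ehi := hiSum_le_hiSumZ n2 νd Tn Td hνd hTd (2 * Real.pi / L0) hTR (L0 / 4) S hpos s a n D hn
  have etail := tailConst_le_tailConstQ n2 νd hνd (hn1.trans hn12) hc (L0 / 4 - 2 * S) n (by omega)
  have hloR : ((clo : ℚ) : ℝ) * D ≤ ((loSumZ n1 νd (L0 / 4) S s a n D : ℤ) : ℝ) := by exact_mod_cast hlo
  have hhiR : ((hiSumZ n2 νd Tn Td (L0 / 4) S s a n D : ℤ) : ℝ)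
      ≤ (((chi : ℚ) : ℝ) - ((tailConstQ n2 νd (L0 / 4 - 2 * S) n : ℚ) : ℝ)) * D := by exact_mod_cast hhi
  constructor
  · -- lower
    have : ((clo : ℚ) : ℝ) ≤ loSum ((n1 : ℝ) / νd) (L0 / 4) S s a := by
      rw [← mul_le_mul_iff_left₀ hDR]
      calc ((clo : ℚ) : ℝ) * D ≤ _ := hloR
        _ ≤ (D : ℝ) * loSum ((n1 : ℝ) / νd) (L0 / 4) S s a := elo
        _ = loSum ((n1 : ℝ) / νd) (L0 / 4) S s a * D := mul_comm _ _
    exact this.trans hmid_lo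
  · -- upper
    have : hiSum ((n2 : ℝ) / νd) (2 * Real.pi / L0) (L0 / 4) S s a
        ≤ ((chi : ℚ) : ℝ) - ((tailConstQ n2 νd (L0 / 4 - 2 * S) n : ℚ) : ℝ) := by
      rw [← mul_le_mul_iff_left₀ hDR]
      calc hiSum ((n2 : ℝ) / νd) (2 * Real.pi / L0) (L0 / 4) S s a * D
          = (D : ℝ) * hiSum ((n2 : ℝ) / νd) (2 * Real.pi / L0) (L0 / 4) S s a := mul_comm _ _
        _ ≤ _ := ehi
        _ ≤ _ := hhiR
    linarith

end Summit.HubbardSuperconductivity.HubbardSuperconductivity.Theorems.AnisotropyChord.Transfer.Fibre3.B1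

end
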